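import Literature.IUT.HodgeArakelov.LabelClassesOfCuspsLevelTie
import Literature.IUT.HodgeArakelov.LabelClassesOfCuspsCardGenuineLevelV
import Literature.IUT.HodgeArakelov.FlTorsorStructureConjGenuine
import Literature.IUT.HodgeArakelov.PlusMinusTowerCoverModelTempered
import HarnessLib

/-!
# [IUTchII] Def 2.3 (iii)/(v) at the GENUINE tower: the natural level map `LabCusp^±(Π_v) → LabCusp^±(Π̂^±_v)` EXISTS, is UNIQUE and BIJECTIVE,
# and the `𝔽^±_l`-torsor structure of record is tied to a level-`Π_v` structure through it (GAP-LEDGER G-w5d243-2 at the tower of record)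

S. Mochizuki, *Inter-universal Teichmüller theory II*, kurims manuscript (Dec. 2020), §2 Def 2.3 (ii) p. 68, (iii) p. 68, (v) p. 69 («the images …
in `LabCusp^±(Π_⊆)` of the various structures on `LabCusp^±(Π_v)` reviewed in (iii) determine [cf. [IUTchI], Definition 6.1, (i)] a natural
`𝔽^±_l`-torsor structure on `LabCusp^±(Π_⊆)`») [claim: Mochizuki2012, status: disputed] (IUTchII §2 Def 2.3 (v), kurims p.69) (D-0012 claim key;
record-only).  Inputs in print: [SemiAnbd] Thm 6.5 (ii)/(iii) pp. 71–72 [cite: MochizukiSemiAnbd2006, Thm 6.5(ii) p.71]; [AbsTopI] Lem 4.5 (vi) p. 55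
[cite: MochizukiAbsTopI2012, Lemma 4.5 (vi) p.55]; [EtTh] Def 2.1 p. 36, Def 2.5 (i) p. 39 [cite: MochizukiEtTh2009, Def 2.5 (i) p.39].

abc-iut cell, seat abc-iut-w5-d132 (gen 7), GAP-LEDGER row **G-w5d243-2**, instance of the pure group theory `LabelClassesOfCuspsLevelTie` at
abc-iut-L6-t19's genuine tower `PlusMinusTower.ofCoverModel` (any injective profinite completion `ι : Π^tp_C → Q`) / `ofPiCHat` (tower of record),
for the SPLIT PAIR of cuspidal data of record: the level-`Π_v` datum `Cu` (cusps of `Π^±_v` = the `ι(inclX Π^tp_X)`-conjugates of `Ĵ₀ = ι(inclX I_{x₀})`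
(`hCuPM`), cusps of `Π_v` = intersections (`hlev`), Rmk 2.3.1 (`hR231`); p456452) and the profinite datum `CuHat` (p432649 characterisation `hCu`).
PROOF-ONLY (no `def`, no instance, no new named fact):

* **`exists_levelMap_ofCoverModel`** — there IS `f : LabCusp^±(Π_v) → LabCusp^±(Π̂^±_v)` with `f ⟦r (Ĵ₀ ∩ Π_v) r⁻¹⟧ = ⟦r Ĵ₀ r⁻¹⟧` for every
  `r ∈ ι(inclX Π^tp_X)` — print's passage `I ↦` (the cusp of the larger group determined by `I`), `r (Ĵ₀ ∩ Π_v) r⁻¹ ≤ r Ĵ₀ r⁻¹`; modulo [SemiAnbd]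
  Thm 6.5 (ii) (F-1658 `DecompCommensurablyTerminal` + `DecompEqCommensuratorOfOpenInertia`, BY NAME), `op`, «unique cusp», `hN`, `hZ`; it is
  UNIQUE by the interface-level `levelMap_unique` (applies verbatim to the two homogeneity theorems p456452 / p448608);
* **`levelMap_injective_ofCoverModel`** — it is INJECTIVE, modulo in addition the ONE profinite binder `h45vi` ([AbsTopI] Lem 4.5 (vi), F-0207 at the
  instance: cusp separation in the profinite completion — the binder of p449023);
* **`levelMap_bijective_ofCoverModel`** — it is BIJECTIVE (both counts `= l`: p456452, p449023; in addition [SemiAnbd] Thm 6.5 (iii) F-1674 for the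
  inversion); the packaged form `∃ f, natural ∧ bijective` is delivered at the tower of record by the next item;
* **`exists_levelMap_labCuspStructure_flTorsorStructureConj_ofPiCHat`** — THE TIE AT THE TOWER OF RECORD: there exist SIMULTANEOUSLY the natural
  bijection `f`, a Def 2.3 (v) successor structure `F : FlTorsorStructureConj CuHat` (abc-iut-w5-d132 p450102, modulo `hR1c` «the inversion reverses
  `Z`») and a Def 2.3 (iii) structure `L : LabCuspStructure Cu` with `L.toFl = F.chart ∘ f` — the wanted law `chart_imageV` of G-w5d243-2 HOLDS for
  this triple (`ε = 1`, `a = 0`); by `LabelClassesOfCuspsLevelTie.exists_quotIso_eq_conj_of_chart_comp_affine` any two successor structures obeying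
  the law against `(L, f)` have CONJUGATE `quotIso` — «hence determines a natural outer isomorphism».

HONEST LABEL: theorems about the kernel's genuine tower over abc-iut-L2's [EtTh] interface data, modulo the named binders of p456452 / p449023 /
p450102 (F-1658 family, F-1674, F-0207-at-the-instance `h45vi`, (R1c) `hR1c`, `op`, «unique cusp», `hZ`, `hN`) and the level clauses of the two data;
the def-bearing interface fields `imageV` / `chart_imageV` remain the interface owner's (abc-iut-L6-t1) — this file is the evidence that they are
well-posed and satisfiable at the tower of record.  Nothing of the series is asserted; no side taken on [IUTchIII] Cor 3.12; typed ≠ proved;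
witnessed ≠ endorsed; nothing here asserts abc proved or refuted.
-/

noncomputable section

namespace Literature.IUT.HodgeArakelov

open Literature.AnabelianGeometry Literature.AnabelianGeometry.EtaleTheta Literature.AnabelianGeometry.SemiGraphs
open scoped Pointwise

namespace PlusMinusTower

variable {p : ℕ} [Fact p.Prime] {M : MuTwoSetting p} (e : M.CLevelData)
  {E : M.toThetaSetting.EtaleThetaData} {l : ℕ} (C : E.DoubleUnderline l) {N : ℕ+}
  (μ : M.toThetaSetting.CyclotomeMod l N) (hC : M.toThetaSetting.Compat) (hS : M.toThetaSetting.Sec2Hyps)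
  (hl : l.Prime) (hp2 : p ≠ 2) (hpl : p ≠ l) (hζ : ∃ ζ : M.toThetaSetting.K, IsPrimitiveRoot ζ (4 * l))
  {η : (C.thetaEnvData μ hC hS).PiYdd → MuN p N} (hη : η ∈ (C.thetaEnvData μ hC hS).thetaCocycles)
  {Q : Type} [Group Q] [TopologicalSpace Q] [IsTopologicalGroup Q]
  (ι : M.GtpC →ₜ* Q) (hι : IsProfiniteCompletion ι) (hinj : Function.Injective ι)
  (Φ : Q →* GQp p) (hΦ : ∀ g : M.GtpC, Φ (ι g) = e.augC g) (hΦK : Φ.range = M.GK)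
  (hZ : Thm16Sub.KerToZIsCompactlyGenerated M.toThetaSetting) (hN : (C.Huu.subgroupOf (M.GtpXu l)).Normal)
  {P : TopGroup.{0}} (T : TemperedCoverings (BadPlaceSetting.ofUnderline C μ hC hS hl hp2 hpl hζ hη) P) {x₀ : M.Pt}

/-! ## 1. The group-theoretic inputs of the level map at `ofCoverModel` -/

section Inputs

/-- `Ĵ₀ = ι(inclX I_{x₀}) ≤ Π̂^±_v`. [cite: MochizukiEtTh2009, Def 2.5 (i) p.39] -/
theorem map_inertia_le_pmHat (op : M.toThetaSetting.OncePuncturedData) (hx₀ : M.IsCusp x₀) :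
    (((M.toTemperedCurve.inertia x₀).map M.inclX).map ι.toMonoidHom :
        Subgroup (ofCoverModel e C μ hC hS hl hp2 hpl hζ hη ι hι hinj Φ hΦ hΦK hZ hN T).Corhat) ≤
      (ofCoverModel e C μ hC hS hl hp2 hpl hζ hη ι hι hinj Φ hΦ hΦK hZ hN T).pmHat := by
  change (((M.toTemperedCurve.inertia x₀).map M.inclX).map ι.toMonoidHom : Subgroup Q) ≤
    (((M.GtpXu l).map M.inclX).map ι.toMonoidHom).topologicalClosure
  exact (Subgroup.map_mono (Subgroup.map_mono (inertia_le_GtpXu op hx₀))).trans (Subgroup.le_topologicalClosure _)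

/-- `Π^±_v ≤ ι(inclX Π^tp_X)`. [cite: MochizukiEtTh2009, Def 2.5 (i) p.39] -/
theorem piPM_le_rangeX :
    (ofCoverModel e C μ hC hS hl hp2 hpl hζ hη ι hι hinj Φ hΦ hΦK hZ hN T).piPM ≤
      (M.inclX.range.map ι.toMonoidHom : Subgroup (ofCoverModel e C μ hC hS hl hp2 hpl hζ hη ι hι hinj Φ hΦ hΦK hZ hN T).Corhat) := by
  rw [piPM_ofCoverModel]
  exact Subgroup.map_mono (Subgroup.map_le_range _ _)

/-- `ι(inclX Π^tp_X)` normalises `Π^±_v`. [cite: MochizukiEtTh2009, Def 2.5 (i) p.39] -/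
theorem conj_smul_piPM_of_mem_rangeX {r : (ofCoverModel e C μ hC hS hl hp2 hpl hζ hη ι hι hinj Φ hΦ hΦK hZ hN T).Corhat}
    (hr : r ∈ (M.inclX.range.map ι.toMonoidHom : Subgroup (ofCoverModel e C μ hC hS hl hp2 hpl hζ hη ι hι hinj Φ hΦ hΦK hZ hN T).Corhat)) :
    MulAut.conj r • (ofCoverModel e C μ hC hS hl hp2 hpl hζ hη ι hι hinj Φ hΦ hΦK hZ hN T).piPM =
      (ofCoverModel e C μ hC hS hl hp2 hpl hζ hη ι hι hinj Φ hΦ hΦK hZ hN T).piPM := by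
  rw [piPM_ofCoverModel]
  exact conj_smul_map_GtpXu_of_mem_rangeX ι hr

/-- `Ĵ₀ ∩ Π_v = ι(inclX(I_{x₀} ∩ Π^tp_{X̲̲}))`. [cite: MochizukiEtTh2009, Def 2.5 (i) p.39] -/
theorem map_inertia_inf_piV_eq :
    (((M.toTemperedCurve.inertia x₀).map M.inclX).map ι.toMonoidHom :
        Subgroup (ofCoverModel e C μ hC hS hl hp2 hpl hζ hη ι hι hinj Φ hΦ hΦK hZ hN T).Corhat) ⊓
          (ofCoverModel e C μ hC hS hl hp2 hpl hζ hη ι hι hinj Φ hΦ hΦK hZ hN T).piV =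
      (((M.toTemperedCurve.inertia x₀ ⊓ C.Huu).map M.inclX).map ι.toMonoidHom :
        Subgroup (ofCoverModel e C μ hC hS hl hp2 hpl hζ hη ι hι hinj Φ hΦ hΦK hZ hN T).Corhat) := by
  have hV : (ofCoverModel e C μ hC hS hl hp2 hpl hζ hη ι hι hinj Φ hΦ hΦK hZ hN T).piV =
      ((C.Huu.map M.inclX).map ι.toMonoidHom : Subgroup (ofCoverModel e C μ hC hS hl hp2 hpl hζ hη ι hι hinj Φ hΦ hΦK hZ hN T).Corhat) :=
    piV_ofCoverModel e C μ hC hS hl hp2 hpl hζ hη ι hι hinj Φ hΦ hΦK hZ hN T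
  rw [hV, Subgroup.map_map, Subgroup.map_map, Subgroup.map_map]
  exact (Subgroup.map_inf _ _ _ (injective_ι_comp_inclX ι hinj)).symm

/-- **The level-1 stabiliser is `Π^±_v`**: `N(N_{Π^±_v}(Ĵ₀ ∩ Π_v)) ∩ ι(inclX Π^tp_X) ≤ Π^±_v` — `N_{Π^±_v}(Ĵ₀ ∩ Π_v) = ι(inclX D_{x₀})` by [SemiAnbd]
Thm 6.5 (ii) (`h65ii`) and `N_{Π^tp_X}(D_{x₀}) = D_{x₀} ≤ Π^tp_{X̲}` by commensurable terminality (`h65`) (both F-1658, BY NAME; p456452).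
[cite: MochizukiSemiAnbd2006, Thm 6.5(ii) p.71] -/
theorem normalizer_normalizer_inf_rangeX_le_piPM (op : M.toThetaSetting.OncePuncturedData) (hx₀ : M.IsCusp x₀)
    (h65 : M.toTemperedCurve.DecompCommensurablyTerminal) (h65ii : M.toTemperedCurve.DecompEqCommensuratorOfOpenInertia) :
    Subgroup.normalizer ((Subgroup.normalizer
        (((((M.toTemperedCurve.inertia x₀).map M.inclX).map ι.toMonoidHom :
            Subgroup (ofCoverModel e C μ hC hS hl hp2 hpl hζ hη ι hι hinj Φ hΦ hΦK hZ hN T).Corhat) ⊓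
          (ofCoverModel e C μ hC hS hl hp2 hpl hζ hη ι hι hinj Φ hΦ hΦK hZ hN T).piV : Subgroup _) : Set _) ⊓
        (ofCoverModel e C μ hC hS hl hp2 hpl hζ hη ι hι hinj Φ hΦ hΦK hZ hN T).piPM : Subgroup _) : Set _) ⊓
      (M.inclX.range.map ι.toMonoidHom : Subgroup (ofCoverModel e C μ hC hS hl hp2 hpl hζ hη ι hι hinj Φ hΦ hΦK hZ hN T).Corhat) ≤
    (ofCoverModel e C μ hC hS hl hp2 hpl hζ hη ι hι hinj Φ hΦ hΦK hZ hN T).piPM := by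
  have hPM : (ofCoverModel e C μ hC hS hl hp2 hpl hζ hη ι hι hinj Φ hΦ hΦK hZ hN T).piPM =
      (((M.GtpXu l).map M.inclX).map ι.toMonoidHom : Subgroup (ofCoverModel e C μ hC hS hl hp2 hpl hζ hη ι hι hinj Φ hΦ hΦK hZ hN T).Corhat) :=
    piPM_ofCoverModel e C μ hC hS hl hp2 hpl hζ hη ι hι hinj Φ hΦ hΦK hZ hN T
  -- `N_{Π^±_v}(Ĵ₀ ∩ Π_v) = ι(inclX D_{x₀})`
  have hN₀ : Subgroup.normalizer ((((M.toTemperedCurve.inertia x₀ ⊓ C.Huu).map M.inclX).map ι.toMonoidHom :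
        Subgroup (ofCoverModel e C μ hC hS hl hp2 hpl hζ hη ι hι hinj Φ hΦ hΦK hZ hN T).Corhat) : Set _) ⊓
          (ofCoverModel e C μ hC hS hl hp2 hpl hζ hη ι hι hinj Φ hΦ hΦK hZ hN T).piPM =
      (((M.decomp x₀).map M.inclX).map ι.toMonoidHom : Subgroup (ofCoverModel e C μ hC hS hl hp2 hpl hζ hη ι hι hinj Φ hΦ hΦK hZ hN T).Corhat) := by
    rw [hPM]
    exact normalizer_map_inertiaInfHuu_inf_piPM_eq C ι hinj hN op hx₀ h65ii
  rw [map_inertia_inf_piV_eq e C μ hC hS hl hp2 hpl hζ hη ι hι hinj Φ hΦ hΦK hZ hN T, hN₀]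
  rintro r ⟨hr, hrX⟩
  rw [hPM]
  exact normalizer_map_decomp_le_piPM ι hinj op hx₀ h65 hrX (mem_normalizer_iff_conj_smul_eq.mp hr)

/-- **The level-2 stabiliser meets `ι(inclX Π^tp_X)` inside `Π^±_v`**: `(N(N(Ĵ₀) ∩ Π̂^±_v) · Π̂^±_v) ∩ ι(inclX Π^tp_X) ≤ Π^±_v` — it meets
`Π̂_X = cl ι(inclX Π^tp_X)` inside `Π̂^±_v` (`sup_inf_le_pmHat_of_inputs` with `D̂ = ι(inclX D_{x₀})` and the separation binder `h45vi`), and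
`Π^cor_v ∩ Π̂^±_v = Π^±_v` (abc-iut-L6-t19 `cor_inf_pmHat_ofCoverModel`). [cite: MochizukiAbsTopI2012, Lemma 4.5 (vi) p.55] -/
theorem stabHat_inf_rangeX_le_piPM (op : M.toThetaSetting.OncePuncturedData) (hx₀ : M.IsCusp x₀)
    (h45vi : Subgroup.normalizer ((((M.toTemperedCurve.inertia x₀).map M.inclX).map ι.toMonoidHom : Subgroup Q) : Set Q) ⊓
        (M.inclX.range.map ι.toMonoidHom).topologicalClosure ≤ ((M.decomp x₀).map M.inclX).map ι.toMonoidHom) :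
    (Subgroup.normalizer ((Subgroup.normalizer
        ((((M.toTemperedCurve.inertia x₀).map M.inclX).map ι.toMonoidHom :
            Subgroup (ofCoverModel e C μ hC hS hl hp2 hpl hζ hη ι hι hinj Φ hΦ hΦK hZ hN T).Corhat) : Set _) ⊓
          (ofCoverModel e C μ hC hS hl hp2 hpl hζ hη ι hι hinj Φ hΦ hΦK hZ hN T).pmHat : Subgroup _) : Set _) ⊔
        (ofCoverModel e C μ hC hS hl hp2 hpl hζ hη ι hι hinj Φ hΦ hΦK hZ hN T).pmHat) ⊓
      (M.inclX.range.map ι.toMonoidHom : Subgroup (ofCoverModel e C μ hC hS hl hp2 hpl hζ hη ι hι hinj Φ hΦ hΦK hZ hN T).Corhat) ≤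
    (ofCoverModel e C μ hC hS hl hp2 hpl hζ hη ι hι hinj Φ hΦ hΦK hZ hN T).piPM := by
  rintro r ⟨hrS, hrX⟩
  -- (1) inside `Π̂_X`, the stabiliser lies in `Π̂^±_v`
  have hPX : (ofCoverModel e C μ hC hS hl hp2 hpl hζ hη ι hι hinj Φ hΦ hΦK hZ hN T).pmHat ≤
      ((M.inclX.range.map ι.toMonoidHom : Subgroup Q).topologicalClosure :
        Subgroup (ofCoverModel e C μ hC hS hl hp2 hpl hζ hη ι hι hinj Φ hΦ hΦK hZ hN T).Corhat) := by
    change ((((M.GtpXu l).map M.inclX).map ι.toMonoidHom).topologicalClosure : Subgroup Q) ≤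
      (M.inclX.range.map ι.toMonoidHom).topologicalClosure
    exact Subgroup.topologicalClosure_mono (Subgroup.map_mono (Subgroup.map_le_range _ _))
  have hDP : (((M.decomp x₀).map M.inclX).map ι.toMonoidHom :
      Subgroup (ofCoverModel e C μ hC hS hl hp2 hpl hζ hη ι hι hinj Φ hΦ hΦK hZ hN T).Corhat) ≤
        (ofCoverModel e C μ hC hS hl hp2 hpl hζ hη ι hι hinj Φ hΦ hΦK hZ hN T).pmHat := by
    change (((M.decomp x₀).map M.inclX).map ι.toMonoidHom : Subgroup Q) ≤
      (((M.GtpXu l).map M.inclX).map ι.toMonoidHom).topologicalClosure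
    exact (Subgroup.map_mono (Subgroup.map_mono (decomp_le_GtpXu op hx₀))).trans (Subgroup.le_topologicalClosure _)
  have hrPM : r ∈ (ofCoverModel e C μ hC hS hl hp2 hpl hζ hη ι hι hinj Φ hΦ hΦK hZ hN T).pmHat :=
    sup_inf_le_pmHat_of_inputs (W := ofCoverModel e C μ hC hS hl hp2 hpl hζ hη ι hι hinj Φ hΦ hΦK hZ hN T)
      (Xh := ((M.inclX.range.map ι.toMonoidHom : Subgroup Q).topologicalClosure))
      (D := ((M.decomp x₀).map M.inclX).map ι.toMonoidHom) hPX hDP (map_decomp_le_normalizer_map_inertia ι) h45vi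
      (fun q hq => conj_smul_map_inertia_of_decomp e ι Φ hΦ q hq)
      ⟨hrS, ((M.inclX.range.map ι.toMonoidHom : Subgroup Q)).le_topologicalClosure hrX⟩
  -- (2) `Π^cor_v ∩ Π̂^±_v = Π^±_v`
  have hrcor : r ∈ (ofCoverModel e C μ hC hS hl hp2 hpl hζ hη ι hι hinj Φ hΦ hΦK hZ hN T).cor := by
    obtain ⟨w, -, rfl⟩ := hrX
    exact ⟨w, rfl⟩
  rw [← cor_inf_pmHat_ofCoverModel e C μ hC hS hl hp2 hpl hζ hη ι hι hinj Φ hΦ hΦK hZ hN T]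
  exact ⟨hrcor, hrPM⟩

end Inputs

/-! ## 2. The natural level map at `ofCoverModel`: existence, uniqueness, injectivity, bijectivity -/

section Tower

/-- **THE NATURAL LEVEL MAP `LabCusp^±(Π_v) → LabCusp^±(Π̂^±_v)` EXISTS AT THE GENUINE TOWER** for the split pair of record `(Cu, CuHat)`:
`f ⟦r (Ĵ₀ ∩ Π_v) r⁻¹⟧ = ⟦r Ĵ₀ r⁻¹⟧` for every `r ∈ ι(inclX Π^tp_X)` — modulo [SemiAnbd] Thm 6.5 (ii) (F-1658: `h65`, `h65ii`, BY NAME), `op`, «unique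
cusp», `hZ`, `hN` and the data's level clauses. [claim: Mochizuki2012, status: disputed] (IUTchII §2 Def 2.3 (v), kurims p.69) -/
theorem exists_levelMap_ofCoverModel (op : M.toThetaSetting.OncePuncturedData) (hx₀ : M.IsCusp x₀)
    (huniq : ∀ x' : M.Pt, M.IsCusp x' → x' = x₀)
    (h65 : M.toTemperedCurve.DecompCommensurablyTerminal) (h65ii : M.toTemperedCurve.DecompEqCommensuratorOfOpenInertia)
    (Cu CuHat : CuspidalInertiaData (ofCoverModel e C μ hC hS hl hp2 hpl hζ hη ι hι hinj Φ hΦ hΦK hZ hN T))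
    (hCuPM : ∀ I : Subgroup (ofCoverModel e C μ hC hS hl hp2 hpl hζ hη ι hι hinj Φ hΦ hΦK hZ hN T).Corhat,
      Cu.IsCuspidalInertia (ofCoverModel e C μ hC hS hl hp2 hpl hζ hη ι hι hinj Φ hΦ hΦK hZ hN T).piPM I ↔
        ∃ r ∈ (M.inclX.range.map ι.toMonoidHom : Subgroup (ofCoverModel e C μ hC hS hl hp2 hpl hζ hη ι hι hinj Φ hΦ hΦK hZ hN T).Corhat),
          I = MulAut.conj r • (((M.toTemperedCurve.inertia x₀).map M.inclX).map ι.toMonoidHom :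
            Subgroup (ofCoverModel e C μ hC hS hl hp2 hpl hζ hη ι hι hinj Φ hΦ hΦK hZ hN T).Corhat))
    (hlev : ∀ J : Subgroup (ofCoverModel e C μ hC hS hl hp2 hpl hζ hη ι hι hinj Φ hΦ hΦK hZ hN T).Corhat,
      Cu.IsCuspidalInertia (ofCoverModel e C μ hC hS hl hp2 hpl hζ hη ι hι hinj Φ hΦ hΦK hZ hN T).piV J ↔
        J ≤ (ofCoverModel e C μ hC hS hl hp2 hpl hζ hη ι hι hinj Φ hΦ hΦK hZ hN T).piV ∧
          ∃ I₀, Cu.IsCuspidalInertia (ofCoverModel e C μ hC hS hl hp2 hpl hζ hη ι hι hinj Φ hΦ hΦK hZ hN T).piPM I₀ ∧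
            J = I₀ ⊓ (ofCoverModel e C μ hC hS hl hp2 hpl hζ hη ι hι hinj Φ hΦ hΦK hZ hN T).piV)
    (hR231 : Rmk231_powers Cu (ofCoverModel e C μ hC hS hl hp2 hpl hζ hη ι hι hinj Φ hΦ hΦK hZ hN T).piV
      (ofCoverModel e C μ hC hS hl hp2 hpl hζ hη ι hι hinj Φ hΦ hΦK hZ hN T).piPM)
    (hCu : ∀ Q' J : Subgroup (ofCoverModel e C μ hC hS hl hp2 hpl hζ hη ι hι hinj Φ hΦ hΦK hZ hN T).Corhat,
      CuHat.IsCuspidalInertia Q' J ↔ J ≤ Q' ∧ ∃ i : {x : M.Pt // M.IsCusp x} × M.GtpC,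
        ∃ γ ∈ (ofCoverModel e C μ hC hS hl hp2 hpl hζ hη ι hι hinj Φ hΦ hΦK hZ hN T).pmHat,
          J = MulAut.conj γ •
            ((((MulAut.conj i.2 • (M.toTemperedCurve.inertia i.1.1).map M.inclX) ⊓ (M.GtpXu l).map M.inclX).map
              ι.toMonoidHom : Subgroup (ofCoverModel e C μ hC hS hl hp2 hpl hζ hη ι hι hinj Φ hΦ hΦK hZ hN T).Corhat)).topologicalClosure) :
    ∃ f : LabCuspPM Cu (ofCoverModel e C μ hC hS hl hp2 hpl hζ hη ι hι hinj Φ hΦ hΦK hZ hN T).piV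
        (ofCoverModel e C μ hC hS hl hp2 hpl hζ hη ι hι hinj Φ hΦ hΦK hZ hN T).piPM →
      LabCuspPM CuHat (ofCoverModel e C μ hC hS hl hp2 hpl hζ hη ι hι hinj Φ hΦ hΦK hZ hN T).pmHat
        (ofCoverModel e C μ hC hS hl hp2 hpl hζ hη ι hι hinj Φ hΦ hΦK hZ hN T).pmHat,
      ∀ r ∈ (M.inclX.range.map ι.toMonoidHom : Subgroup (ofCoverModel e C μ hC hS hl hp2 hpl hζ hη ι hι hinj Φ hΦ hΦK hZ hN T).Corhat),
        ∀ (I : {I // Cu.IsCuspidalInertia (ofCoverModel e C μ hC hS hl hp2 hpl hζ hη ι hι hinj Φ hΦ hΦK hZ hN T).piV I})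
          (J : {I // CuHat.IsCuspidalInertia (ofCoverModel e C μ hC hS hl hp2 hpl hζ hη ι hι hinj Φ hΦ hΦK hZ hN T).pmHat I}),
          I.1 = MulAut.conj r • ((((M.toTemperedCurve.inertia x₀).map M.inclX).map ι.toMonoidHom :
              Subgroup (ofCoverModel e C μ hC hS hl hp2 hpl hζ hη ι hι hinj Φ hΦ hΦK hZ hN T).Corhat) ⊓
            (ofCoverModel e C μ hC hS hl hp2 hpl hζ hη ι hι hinj Φ hΦ hΦK hZ hN T).piV) →
          J.1 = MulAut.conj r • (((M.toTemperedCurve.inertia x₀).map M.inclX).map ι.toMonoidHom :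
              Subgroup (ofCoverModel e C μ hC hS hl hp2 hpl hζ hη ι hι hinj Φ hΦ hΦK hZ hN T).Corhat) →
          f (Quot.mk _ I) = Quot.mk _ J :=
  exists_levelMap (C₁ := Cu) (C₂ := CuHat)
    (R := (M.inclX.range.map ι.toMonoidHom : Subgroup (ofCoverModel e C μ hC hS hl hp2 hpl hζ hη ι hι hinj Φ hΦ hΦK hZ hN T).Corhat))
    (inf_le_right.trans (ofCoverModel e C μ hC hS hl hp2 hpl hζ hη ι hι hinj Φ hΦ hΦK hZ hN T).piV_le_piPM)
    (piPM_le_rangeX e C μ hC hS hl hp2 hpl hζ hη ι hι hinj Φ hΦ hΦK hZ hN T)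
    (fun _ hr => conj_smul_piPM_of_mem_rangeX e C μ hC hS hl hp2 hpl hζ hη ι hι hinj Φ hΦ hΦK hZ hN T hr)
    (isCuspidalInertia_piV_iff_rangeX e C μ hC hS hl hp2 hpl hζ hη ι hι hinj Φ hΦ hΦK hZ hN T Cu hCuPM hlev hR231)
    (normalizer_normalizer_inf_rangeX_le_piPM e C μ hC hS hl hp2 hpl hζ hη ι hι hinj Φ hΦ hΦK hZ hN T op hx₀ h65 h65ii)
    (ofCoverModel e C μ hC hS hl hp2 hpl hζ hη ι hι hinj Φ hΦ hΦK hZ hN T).emb_le_pmHat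
    (map_inertia_le_pmHat e C μ hC hS hl hp2 hpl hζ hη ι hι hinj Φ hΦ hΦK hZ hN T op hx₀)
    (isCuspidalInertia_pmHat_iff e C μ hC hS hl hp2 hpl hζ hη ι hι hinj Φ hΦ hΦK hZ hN T op hx₀ huniq CuHat hCu)

/-- **THE NATURAL LEVEL MAP IS INJECTIVE** at the genuine tower, modulo in addition the ONE profinite binder `h45vi` ([AbsTopI] Lem 4.5 (vi), F-0207 at
the instance: `N(ι inclX I_{x₀}) ∩ Π̂_X ≤ ι inclX D_{x₀}`). [claim: Mochizuki2012, status: disputed] (IUTchII §2 Def 2.3 (v), kurims p.69) -/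
theorem levelMap_injective_ofCoverModel (op : M.toThetaSetting.OncePuncturedData) (hx₀ : M.IsCusp x₀)
    (huniq : ∀ x' : M.Pt, M.IsCusp x' → x' = x₀)
    (h45vi : Subgroup.normalizer ((((M.toTemperedCurve.inertia x₀).map M.inclX).map ι.toMonoidHom : Subgroup Q) : Set Q) ⊓
        (M.inclX.range.map ι.toMonoidHom).topologicalClosure ≤ ((M.decomp x₀).map M.inclX).map ι.toMonoidHom)
    (Cu CuHat : CuspidalInertiaData (ofCoverModel e C μ hC hS hl hp2 hpl hζ hη ι hι hinj Φ hΦ hΦK hZ hN T))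
    (hCuPM : ∀ I : Subgroup (ofCoverModel e C μ hC hS hl hp2 hpl hζ hη ι hι hinj Φ hΦ hΦK hZ hN T).Corhat,
      Cu.IsCuspidalInertia (ofCoverModel e C μ hC hS hl hp2 hpl hζ hη ι hι hinj Φ hΦ hΦK hZ hN T).piPM I ↔
        ∃ r ∈ (M.inclX.range.map ι.toMonoidHom : Subgroup (ofCoverModel e C μ hC hS hl hp2 hpl hζ hη ι hι hinj Φ hΦ hΦK hZ hN T).Corhat),
          I = MulAut.conj r • (((M.toTemperedCurve.inertia x₀).map M.inclX).map ι.toMonoidHom :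
            Subgroup (ofCoverModel e C μ hC hS hl hp2 hpl hζ hη ι hι hinj Φ hΦ hΦK hZ hN T).Corhat))
    (hlev : ∀ J : Subgroup (ofCoverModel e C μ hC hS hl hp2 hpl hζ hη ι hι hinj Φ hΦ hΦK hZ hN T).Corhat,
      Cu.IsCuspidalInertia (ofCoverModel e C μ hC hS hl hp2 hpl hζ hη ι hι hinj Φ hΦ hΦK hZ hN T).piV J ↔
        J ≤ (ofCoverModel e C μ hC hS hl hp2 hpl hζ hη ι hι hinj Φ hΦ hΦK hZ hN T).piV ∧
          ∃ I₀, Cu.IsCuspidalInertia (ofCoverModel e C μ hC hS hl hp2 hpl hζ hη ι hι hinj Φ hΦ hΦK hZ hN T).piPM I₀ ∧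
            J = I₀ ⊓ (ofCoverModel e C μ hC hS hl hp2 hpl hζ hη ι hι hinj Φ hΦ hΦK hZ hN T).piV)
    (hR231 : Rmk231_powers Cu (ofCoverModel e C μ hC hS hl hp2 hpl hζ hη ι hι hinj Φ hΦ hΦK hZ hN T).piV
      (ofCoverModel e C μ hC hS hl hp2 hpl hζ hη ι hι hinj Φ hΦ hΦK hZ hN T).piPM)
    (hCu : ∀ Q' J : Subgroup (ofCoverModel e C μ hC hS hl hp2 hpl hζ hη ι hι hinj Φ hΦ hΦK hZ hN T).Corhat,
      CuHat.IsCuspidalInertia Q' J ↔ J ≤ Q' ∧ ∃ i : {x : M.Pt // M.IsCusp x} × M.GtpC,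
        ∃ γ ∈ (ofCoverModel e C μ hC hS hl hp2 hpl hζ hη ι hι hinj Φ hΦ hΦK hZ hN T).pmHat,
          J = MulAut.conj γ •
            ((((MulAut.conj i.2 • (M.toTemperedCurve.inertia i.1.1).map M.inclX) ⊓ (M.GtpXu l).map M.inclX).map
              ι.toMonoidHom : Subgroup (ofCoverModel e C μ hC hS hl hp2 hpl hζ hη ι hι hinj Φ hΦ hΦK hZ hN T).Corhat)).topologicalClosure)
    {f : LabCuspPM Cu (ofCoverModel e C μ hC hS hl hp2 hpl hζ hη ι hι hinj Φ hΦ hΦK hZ hN T).piV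
        (ofCoverModel e C μ hC hS hl hp2 hpl hζ hη ι hι hinj Φ hΦ hΦK hZ hN T).piPM →
      LabCuspPM CuHat (ofCoverModel e C μ hC hS hl hp2 hpl hζ hη ι hι hinj Φ hΦ hΦK hZ hN T).pmHat
        (ofCoverModel e C μ hC hS hl hp2 hpl hζ hη ι hι hinj Φ hΦ hΦK hZ hN T).pmHat}
    (hf : ∀ r ∈ (M.inclX.range.map ι.toMonoidHom : Subgroup (ofCoverModel e C μ hC hS hl hp2 hpl hζ hη ι hι hinj Φ hΦ hΦK hZ hN T).Corhat),
        ∀ (I : {I // Cu.IsCuspidalInertia (ofCoverModel e C μ hC hS hl hp2 hpl hζ hη ι hι hinj Φ hΦ hΦK hZ hN T).piV I})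
          (J : {I // CuHat.IsCuspidalInertia (ofCoverModel e C μ hC hS hl hp2 hpl hζ hη ι hι hinj Φ hΦ hΦK hZ hN T).pmHat I}),
          I.1 = MulAut.conj r • ((((M.toTemperedCurve.inertia x₀).map M.inclX).map ι.toMonoidHom :
              Subgroup (ofCoverModel e C μ hC hS hl hp2 hpl hζ hη ι hι hinj Φ hΦ hΦK hZ hN T).Corhat) ⊓
            (ofCoverModel e C μ hC hS hl hp2 hpl hζ hη ι hι hinj Φ hΦ hΦK hZ hN T).piV) →
          J.1 = MulAut.conj r • (((M.toTemperedCurve.inertia x₀).map M.inclX).map ι.toMonoidHom :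
              Subgroup (ofCoverModel e C μ hC hS hl hp2 hpl hζ hη ι hι hinj Φ hΦ hΦK hZ hN T).Corhat) →
          f (Quot.mk _ I) = Quot.mk _ J) :
    Function.Injective f :=
  levelMap_injective (C₁ := Cu) (C₂ := CuHat)
    (inf_le_right.trans (ofCoverModel e C μ hC hS hl hp2 hpl hζ hη ι hι hinj Φ hΦ hΦK hZ hN T).piV_le_piPM)
    (fun _ hr => conj_smul_piPM_of_mem_rangeX e C μ hC hS hl hp2 hpl hζ hη ι hι hinj Φ hΦ hΦK hZ hN T hr)
    (isCuspidalInertia_piV_iff_rangeX e C μ hC hS hl hp2 hpl hζ hη ι hι hinj Φ hΦ hΦK hZ hN T Cu hCuPM hlev hR231)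
    (map_inertia_le_pmHat e C μ hC hS hl hp2 hpl hζ hη ι hι hinj Φ hΦ hΦK hZ hN T op hx₀)
    (isCuspidalInertia_pmHat_iff e C μ hC hS hl hp2 hpl hζ hη ι hι hinj Φ hΦ hΦK hZ hN T op hx₀ huniq CuHat hCu)
    (stabHat_inf_rangeX_le_piPM e C μ hC hS hl hp2 hpl hζ hη ι hι hinj Φ hΦ hΦK hZ hN T op hx₀ h45vi) hf

/-- **THE NATURAL LEVEL MAP IS A BIJECTION `LabCusp^±(Π_v) ≃ LabCusp^±(Π̂^±_v)`** at the genuine tower: injective, and both sides have `l` elements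
(p456452 `card_labCuspPM_piV_ofCoverModel_eq_l`, p449023 `card_labCuspPM_ofCoverModel_eq_l`); modulo F-1658 (`h65`, `h65ii`), F-1674 (`h65iii`),
F-0207-at-the-instance (`h45vi`), `op`, «unique cusp», `hZ`, `hN`. [claim: Mochizuki2012, status: disputed] (IUTchII §2 Def 2.3 (v), kurims p.69) -/
theorem levelMap_bijective_ofCoverModel (op : M.toThetaSetting.OncePuncturedData) (hx₀ : M.IsCusp x₀)
    (huniq : ∀ x' : M.Pt, M.IsCusp x' → x' = x₀) (h65 : M.toTemperedCurve.DecompCommensurablyTerminal)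
    (h65ii : M.toTemperedCurve.DecompEqCommensuratorOfOpenInertia) (h65iii : M.toTemperedCurve.IsoPreservesCuspidalDecomp M.toTemperedCurve)
    (h45vi : Subgroup.normalizer ((((M.toTemperedCurve.inertia x₀).map M.inclX).map ι.toMonoidHom : Subgroup Q) : Set Q) ⊓
        (M.inclX.range.map ι.toMonoidHom).topologicalClosure ≤ ((M.decomp x₀).map M.inclX).map ι.toMonoidHom)
    (Cu CuHat : CuspidalInertiaData (ofCoverModel e C μ hC hS hl hp2 hpl hζ hη ι hι hinj Φ hΦ hΦK hZ hN T))
    (hCuPM : ∀ I : Subgroup (ofCoverModel e C μ hC hS hl hp2 hpl hζ hη ι hι hinj Φ hΦ hΦK hZ hN T).Corhat,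
      Cu.IsCuspidalInertia (ofCoverModel e C μ hC hS hl hp2 hpl hζ hη ι hι hinj Φ hΦ hΦK hZ hN T).piPM I ↔
        ∃ r ∈ (M.inclX.range.map ι.toMonoidHom : Subgroup (ofCoverModel e C μ hC hS hl hp2 hpl hζ hη ι hι hinj Φ hΦ hΦK hZ hN T).Corhat),
          I = MulAut.conj r • (((M.toTemperedCurve.inertia x₀).map M.inclX).map ι.toMonoidHom :
            Subgroup (ofCoverModel e C μ hC hS hl hp2 hpl hζ hη ι hι hinj Φ hΦ hΦK hZ hN T).Corhat))
    (hlev : ∀ J : Subgroup (ofCoverModel e C μ hC hS hl hp2 hpl hζ hη ι hι hinj Φ hΦ hΦK hZ hN T).Corhat,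
      Cu.IsCuspidalInertia (ofCoverModel e C μ hC hS hl hp2 hpl hζ hη ι hι hinj Φ hΦ hΦK hZ hN T).piV J ↔
        J ≤ (ofCoverModel e C μ hC hS hl hp2 hpl hζ hη ι hι hinj Φ hΦ hΦK hZ hN T).piV ∧
          ∃ I₀, Cu.IsCuspidalInertia (ofCoverModel e C μ hC hS hl hp2 hpl hζ hη ι hι hinj Φ hΦ hΦK hZ hN T).piPM I₀ ∧
            J = I₀ ⊓ (ofCoverModel e C μ hC hS hl hp2 hpl hζ hη ι hι hinj Φ hΦ hΦK hZ hN T).piV)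
    (hR231 : Rmk231_powers Cu (ofCoverModel e C μ hC hS hl hp2 hpl hζ hη ι hι hinj Φ hΦ hΦK hZ hN T).piV
      (ofCoverModel e C μ hC hS hl hp2 hpl hζ hη ι hι hinj Φ hΦ hΦK hZ hN T).piPM)
    (hCu : ∀ Q' J : Subgroup (ofCoverModel e C μ hC hS hl hp2 hpl hζ hη ι hι hinj Φ hΦ hΦK hZ hN T).Corhat,
      CuHat.IsCuspidalInertia Q' J ↔ J ≤ Q' ∧ ∃ i : {x : M.Pt // M.IsCusp x} × M.GtpC,
        ∃ γ ∈ (ofCoverModel e C μ hC hS hl hp2 hpl hζ hη ι hι hinj Φ hΦ hΦK hZ hN T).pmHat,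
          J = MulAut.conj γ •
            ((((MulAut.conj i.2 • (M.toTemperedCurve.inertia i.1.1).map M.inclX) ⊓ (M.GtpXu l).map M.inclX).map
              ι.toMonoidHom : Subgroup (ofCoverModel e C μ hC hS hl hp2 hpl hζ hη ι hι hinj Φ hΦ hΦK hZ hN T).Corhat)).topologicalClosure)
    {f : LabCuspPM Cu (ofCoverModel e C μ hC hS hl hp2 hpl hζ hη ι hι hinj Φ hΦ hΦK hZ hN T).piV
        (ofCoverModel e C μ hC hS hl hp2 hpl hζ hη ι hι hinj Φ hΦ hΦK hZ hN T).piPM →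
      LabCuspPM CuHat (ofCoverModel e C μ hC hS hl hp2 hpl hζ hη ι hι hinj Φ hΦ hΦK hZ hN T).pmHat
        (ofCoverModel e C μ hC hS hl hp2 hpl hζ hη ι hι hinj Φ hΦ hΦK hZ hN T).pmHat}
    (hf : ∀ r ∈ (M.inclX.range.map ι.toMonoidHom : Subgroup (ofCoverModel e C μ hC hS hl hp2 hpl hζ hη ι hι hinj Φ hΦ hΦK hZ hN T).Corhat),
        ∀ (I : {I // Cu.IsCuspidalInertia (ofCoverModel e C μ hC hS hl hp2 hpl hζ hη ι hι hinj Φ hΦ hΦK hZ hN T).piV I})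
          (J : {I // CuHat.IsCuspidalInertia (ofCoverModel e C μ hC hS hl hp2 hpl hζ hη ι hι hinj Φ hΦ hΦK hZ hN T).pmHat I}),
          I.1 = MulAut.conj r • ((((M.toTemperedCurve.inertia x₀).map M.inclX).map ι.toMonoidHom :
              Subgroup (ofCoverModel e C μ hC hS hl hp2 hpl hζ hη ι hι hinj Φ hΦ hΦK hZ hN T).Corhat) ⊓
            (ofCoverModel e C μ hC hS hl hp2 hpl hζ hη ι hι hinj Φ hΦ hΦK hZ hN T).piV) →
          J.1 = MulAut.conj r • (((M.toTemperedCurve.inertia x₀).map M.inclX).map ι.toMonoidHom :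
              Subgroup (ofCoverModel e C μ hC hS hl hp2 hpl hζ hη ι hι hinj Φ hΦ hΦK hZ hN T).Corhat) →
          f (Quot.mk _ I) = Quot.mk _ J) :
    Function.Bijective f :=
  levelMap_bijective_of_card_eq
    (levelMap_injective_ofCoverModel e C μ hC hS hl hp2 hpl hζ hη ι hι hinj Φ hΦ hΦK hZ hN T op hx₀ huniq h45vi Cu CuHat hCuPM hlev hR231
      hCu hf)
    hl.ne_zero
    (card_labCuspPM_piV_ofCoverModel_eq_l e C μ hC hS hl hp2 hpl hζ hη ι hι hinj Φ hΦ hΦK hZ hN T op hx₀ h65 h65ii Cu hCuPM hlev hR231)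
    (card_labCuspPM_ofCoverModel_eq_l e C μ hC hS hl hp2 hpl hζ hη ι hι hinj Φ hΦ hΦK hZ hN T op hx₀ huniq h65iii h45vi CuHat hCu)

end Tower

/-! ## 3. The tie at the tower of record `ofPiCHat`: natural bijection + successor structure + level structure, law `chart_imageV` satisfied -/

section PiCHat

/-- **G-w5d243-2 AT THE TOWER OF RECORD.**  For the split pair of cuspidal data of record `(Cu, CuHat)` of `PlusMinusTower.ofPiCHat` there exist
SIMULTANEOUSLY: the natural BIJECTION `f : LabCusp^±(Π_v) → LabCusp^±(Π̂^±_v)` (`⟦r (Ĵ₀ ∩ Π_v) r⁻¹⟧ ↦ ⟦r Ĵ₀ r⁻¹⟧`, `r ∈ toPiCHat(inclX Π^tp_X)`), a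
Def 2.3 (v) successor structure `F : FlTorsorStructureConj CuHat` (`𝔽^±_l`-torsor chart + conjugation action + `Π_C/Π̂^±_v ≃* 𝔽_l^{⋊±}`, p450102)
and a Def 2.3 (iii) structure `L : LabCuspStructure Cu` (`𝔽_l^×`-action, `η^0`, `η^±`) with **`L.toFl = F.chart ∘ f`** — the law `chart_imageV`
HOLDS for the triple (`ε = 1`, `a = 0`).  Modulo F-1658 (`h65`, `h65ii`), F-1674 (`h65iii`), F-0207-at-the-instance (`h45vi`), (R1c) `hR1c`, `op`,
«unique cusp», `hZ`, `hN` and the level clauses of the two data — the binders of p456452 / p449023 / p450102, nothing new.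
[claim: Mochizuki2012, status: disputed] (IUTchII §2 Def 2.3 (v), kurims p.69) -/
theorem exists_levelMap_labCuspStructure_flTorsorStructureConj_ofPiCHat (op : M.toThetaSetting.OncePuncturedData)
    (hx₀ : M.IsCusp x₀) (huniq : ∀ x' : M.Pt, M.IsCusp x' → x' = x₀) (h65 : M.toTemperedCurve.DecompCommensurablyTerminal)
    (h65ii : M.toTemperedCurve.DecompEqCommensuratorOfOpenInertia) (h65iii : M.toTemperedCurve.IsoPreservesCuspidalDecomp M.toTemperedCurve)
    (h45vi : Subgroup.normalizer ((((M.toTemperedCurve.inertia x₀).map M.inclX).map e.toPiCHat.toMonoidHom : Subgroup e.PiCHat) :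
        Set e.PiCHat) ⊓ (M.inclX.range.map e.toPiCHat.toMonoidHom).topologicalClosure ≤
          ((M.decomp x₀).map M.inclX).map e.toPiCHat.toMonoidHom)
    (hR1c : ∀ w : M.PiTemp, M.toZ (e.conjX M.epsPM w) = (M.toZ w)⁻¹)
    (Cu CuHat : CuspidalInertiaData (ofPiCHat e C μ hC hS hl hp2 hpl hζ hη hZ hN T))
    (hCuPM : ∀ I : Subgroup (ofPiCHat e C μ hC hS hl hp2 hpl hζ hη hZ hN T).Corhat,
      Cu.IsCuspidalInertia (ofPiCHat e C μ hC hS hl hp2 hpl hζ hη hZ hN T).piPM I ↔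
        ∃ r ∈ (M.inclX.range.map e.toPiCHat.toMonoidHom : Subgroup (ofPiCHat e C μ hC hS hl hp2 hpl hζ hη hZ hN T).Corhat),
          I = MulAut.conj r • (((M.toTemperedCurve.inertia x₀).map M.inclX).map e.toPiCHat.toMonoidHom :
            Subgroup (ofPiCHat e C μ hC hS hl hp2 hpl hζ hη hZ hN T).Corhat))
    (hlev : ∀ J : Subgroup (ofPiCHat e C μ hC hS hl hp2 hpl hζ hη hZ hN T).Corhat,
      Cu.IsCuspidalInertia (ofPiCHat e C μ hC hS hl hp2 hpl hζ hη hZ hN T).piV J ↔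
        J ≤ (ofPiCHat e C μ hC hS hl hp2 hpl hζ hη hZ hN T).piV ∧
          ∃ I₀, Cu.IsCuspidalInertia (ofPiCHat e C μ hC hS hl hp2 hpl hζ hη hZ hN T).piPM I₀ ∧
            J = I₀ ⊓ (ofPiCHat e C μ hC hS hl hp2 hpl hζ hη hZ hN T).piV)
    (hR231 : Rmk231_powers Cu (ofPiCHat e C μ hC hS hl hp2 hpl hζ hη hZ hN T).piV (ofPiCHat e C μ hC hS hl hp2 hpl hζ hη hZ hN T).piPM)
    (hCu : ∀ Q' J : Subgroup (ofPiCHat e C μ hC hS hl hp2 hpl hζ hη hZ hN T).Corhat,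
      CuHat.IsCuspidalInertia Q' J ↔ J ≤ Q' ∧ ∃ i : {x : M.Pt // M.IsCusp x} × M.GtpC,
        ∃ γ ∈ (ofPiCHat e C μ hC hS hl hp2 hpl hζ hη hZ hN T).pmHat,
          J = MulAut.conj γ •
            ((((MulAut.conj i.2 • (M.toTemperedCurve.inertia i.1.1).map M.inclX) ⊓ (M.GtpXu l).map M.inclX).map
              e.toPiCHat.toMonoidHom : Subgroup (ofPiCHat e C μ hC hS hl hp2 hpl hζ hη hZ hN T).Corhat)).topologicalClosure) :
    ∃ (f : LabCuspPM Cu (ofPiCHat e C μ hC hS hl hp2 hpl hζ hη hZ hN T).piV (ofPiCHat e C μ hC hS hl hp2 hpl hζ hη hZ hN T).piPM →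
        LabCuspPM CuHat (ofPiCHat e C μ hC hS hl hp2 hpl hζ hη hZ hN T).pmHat (ofPiCHat e C μ hC hS hl hp2 hpl hζ hη hZ hN T).pmHat)
      (F : FlTorsorStructureConj CuHat) (L : LabCuspStructure Cu),
      Function.Bijective f ∧
      (∀ r ∈ (M.inclX.range.map e.toPiCHat.toMonoidHom : Subgroup (ofPiCHat e C μ hC hS hl hp2 hpl hζ hη hZ hN T).Corhat),
        ∀ (I : {I // Cu.IsCuspidalInertia (ofPiCHat e C μ hC hS hl hp2 hpl hζ hη hZ hN T).piV I})
          (J : {I // CuHat.IsCuspidalInertia (ofPiCHat e C μ hC hS hl hp2 hpl hζ hη hZ hN T).pmHat I}),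
          I.1 = MulAut.conj r • ((((M.toTemperedCurve.inertia x₀).map M.inclX).map e.toPiCHat.toMonoidHom :
              Subgroup (ofPiCHat e C μ hC hS hl hp2 hpl hζ hη hZ hN T).Corhat) ⊓ (ofPiCHat e C μ hC hS hl hp2 hpl hζ hη hZ hN T).piV) →
          J.1 = MulAut.conj r • (((M.toTemperedCurve.inertia x₀).map M.inclX).map e.toPiCHat.toMonoidHom :
              Subgroup (ofPiCHat e C μ hC hS hl hp2 hpl hζ hη hZ hN T).Corhat) →
          f (Quot.mk _ I) = Quot.mk _ J) ∧
      ∀ t, L.toFl t = F.chart (f t) := by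
  obtain ⟨f, hf⟩ := exists_levelMap_ofCoverModel e C μ hC hS hl hp2 hpl hζ hη e.toPiCHat e.isProfiniteCompletion_toPiCHat
    e.toPiCHat_injective e.piCData.aug.toMonoidHom (fun g => e.piCData_aug_apply g) e.piCData.range_aug hZ hN T op hx₀ huniq h65 h65ii
    Cu CuHat hCuPM hlev hR231 hCu
  have hbij : Function.Bijective f :=
    levelMap_bijective_ofCoverModel e C μ hC hS hl hp2 hpl hζ hη e.toPiCHat e.isProfiniteCompletion_toPiCHat e.toPiCHat_injective
      e.piCData.aug.toMonoidHom (fun g => e.piCData_aug_apply g) e.piCData.range_aug hZ hN T op hx₀ huniq h65 h65ii h65iii h45vi Cu CuHat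
      hCuPM hlev hR231 hCu hf
  obtain ⟨F⟩ := nonempty_flTorsorStructureConj_ofPiCHat e C μ hC hS hl hp2 hpl hζ hη hZ hN T op hx₀ huniq h65iii h45vi hR1c CuHat hCu
  obtain ⟨L, hL, -, -⟩ := exists_labCuspStructure_toFl_eq_chart_comp hbij F.toFlTorsorStructure
  exact ⟨f, F, L, hbij, hf, hL⟩

end PiCHat

end PlusMinusTower

end Literature.IUT.HodgeArakelov

end
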